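import Summits.QuantumFields.BalabanUV.T4Continuum.Support.NE9HoloSliceOfFamily
import Summits.QuantumFields.BalabanUV.T4Continuum.Support.NE9TwoPointKPOfPencil
import Literature.MathematicalPhysics.QuantumFieldTheory.Balaban1983to89.B13LocEAnalytic
import Literature.Analysis.Complex.GateauxHolomorphicBall
import Summits.QuantumFields.BalabanUV.T4Continuum.Support.NE9FutureProfileReal

/-!
# NE9HoloFamilyOfPencil — ROUTE R4's END FROM THE PENCIL LETTERS («one input set, two ENDs»): the complex new-term family map
# `Q ↦ newTerm act k s U X Q + c` is (c-holo) FRÉCHET-holomorphic on the table ball `‖Q‖ < R₀` ((♮) Graves–Taylor–Hille–Zorn on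
# each line-holomorphic bounded activity, then the cluster sum is holomorphic wherever Kotecký–Preiss holds — `B13LocEAnalytic`) and
# (c-size) bounded by `(2B + B_z)·e^{−κd(X)}` on the inner ball `‖Q‖ ≤ s₀` (TWO-POINT KP from the pencil + pin budget); with (c-real)
# from the END of record's `hΨ` this feeds `NE9HoloSliceOfFamily.ne9_and_fadingMemory_of_holoFamily` — the SAME Bałaban-side
# inputs as the pencil END `NE9TwoPointKPOfPencil` §3, the Earle–Hamilton END and rate instead of the renewal END

Cell `pub-balaban`, T4-DAG §6 NE9; BINDER row NE9 OWNER lineage `b2b-balaban-t4-ne9-p1` gen 60, CRUX PROVER NE9 (ruling e34b3e0c (2));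
route R4 «fading by Earle–Hamilton» (`t4/ROUTES-NE9.md` v4 §L1.0; PRICING-NE9 v4∕v5 «C-R3° and C-R4° share every Bałaban-side input
and differ only in the END and the rate»).  HONEST FRAMING (T4-DAG PAGE 1).  Rung (B)+1 of the FINITE-VOLUME T⁴ programme — NOT
infinite volume, NOT a mass gap, NOT Clay.  NE9 (`T4OutputRate.NE9` ∧ `FadingMemory`) is a cell NEW ESTIMATE, NOT PRINTED in [I] =
[Balaban1987RG1] (CMP **109**), [II] = [Balaban1988RG2Cluster] (CMP **116**), NOT PROVED for Bałaban's E^{(j)}: the theorem below is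
«NE9 ⇐ the named binders»; its displayed Bałaban-side inputs are EXACTLY the pencil END's (`hhol`∕`hsup` = (R-0)[scope] «[II]
Lemma 3 (2.38) read over Lemma 2's box» on the radius `R₀`, `hkp2`, `hdec`, `hpin`, `hΨ`, the structural binders) PLUS the
displayed size `hΨ0` of the new term at the ZERO table (TYPE: (2.41) p. 21 at `𝐕 = 0`), the ℝ-closure of `Adm`, base-free runs,
and a conjugation of the table space fixing the weighted readings (Mathlib's `star`; abstract here); W1 = model O-NE9-1 untouched;
spine 0∕9.  HONEST DEPENDENCY (cell line, verbatim): continuum YM on T⁴ ⇐ BetaPertH ∧ nine spine estimates (0/9 proved); BetaPertH ⇐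
(D1) ∧ (D4) ∧ CAP+tail; G-an2-4 gates asym, D1 and NE2/3/4.  `FlowStep.BetaPertH`, (B), (B^μ) do not occur; [II] for TYPES only.
CONTENT ([folklore]; 0 def, 0 sorry): §1 **`differentiableOn_act_of_lineHolo`** ((♮) on one activity), `isKPVolume_of_majorant`,
**`differentiableOn_newTerm`** (the cluster sum is Fréchet-holomorphic on the table ball — `differentiableOn_truncatedWeight_param_of_kp`);
§2 **`norm_newTerm_le_of_pencil`** (‖newTerm Q‖ ≤ B·e^{−κd(X)} on `closedBall 0 s₀`, `s₀ < R₀`; `twoPointKP_of_lineHolo_ball` ∘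
`norm_newTerm_le_of_twoPointKP`); §3 **`ne9_and_fadingMemory_of_pencil_EH`** (abstract conjugation) and **`…_star`** (Mathlib's `star`, `exists_star_clm_lp` + leaf-02's `isSelfAdjoint_reading`) — THE END: the pencil END's hypotheses + `hΨ0` + σ-data +
ℝ-closure + base-free + the ROOM `ω̂·s₀ + (√2·τ̄)·(2B + B_z) ≤ θ·s₀` ⇒ `NE9 E W κ (prodModuli ((2∕(1−θ))·ℓ) (fun _ => 2θ∕(1+θ))) ∧
FadingMemory …` — NO margin `R₀ − s₀` in the rate, no `lip`, no `hocc`.  DISGUISE TEST: composition; nothing of Bałaban's asserted.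
References (TYPES only): [Balaban1988RG2Cluster] CMP **116** (2.13)–(2.15) pp. 14–15, Lemma 3 (2.38) p. 20, (2.40)–(2.41) p. 21,
(1.36) p. 9; [KoteckyPreiss1986] p. 492–493; [Chae1985] Thm 14.9; [EarleHamilton1970].
-/

noncomputable section

namespace Summit.QuantumFields.BalabanUV.T4Continuum.NE9HoloFamilyOfPencil

open Metric Set ComplexConjugate
open scoped BigOperators ENNReal
open Literature.Probability.LatticeModels
open Literature.MathematicalPhysics.QuantumFieldTheory.Balaban1983to89
open Literature.MathematicalPhysics.QuantumFieldTheory.Balaban1983to89.T4OutputRate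
open Literature.MathematicalPhysics.QuantumFieldTheory.Balaban1983to89.T4ActivityLipschitz
open Literature.MathematicalPhysics.QuantumFieldTheory.Balaban1983to89.T4HistoryLipschitzRecursion
open Literature.MathematicalPhysics.QuantumFieldTheory.Balaban1983to89.T4HistoryLipschitzOuter
open Literature.MathematicalPhysics.QuantumFieldTheory.Balaban1983to89.T4HistoryLipschitzActivity
open Literature.MathematicalPhysics.QuantumFieldTheory.Balaban1983to89.T4HistoryLipschitzSegment
open Literature.MathematicalPhysics.QuantumFieldTheory.Balaban1983to89.T4HistoryLipschitzActivity (ClusterGeom)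
open Literature.Analysis.Complex.GateauxHolomorphic
open Summit.QuantumFields.BalabanUV.T4Continuum.NE9TableReading
open Summit.QuantumFields.BalabanUV.T4Continuum.NE9TwoPointKPOfPencil
open Summit.QuantumFields.BalabanUV.T4Continuum.NE9FutureProfileRecordPrelim
open Summit.QuantumFields.BalabanUV.T4Continuum.NE9HoloSliceOfFamily
open Summit.QuantumFields.BalabanUV.T4Continuum.NE9FutureProfileReal

variable {C : Carriers} (G : ClusterGeom C) {Bg : Type}

/-! ## §1 Holomorphy of the new term in the table, from line-holomorphic dominated activities -/

section Holo

variable {Pot : Type*} [NormedAddCommGroup Pot] [NormedSpace ℂ Pot]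

omit G in
/-- **(♮) ON ONE ACTIVITY**: line-holomorphic on the ball of radius `R₀` (`LineHolo`) and bounded there ⇒ Fréchet-holomorphic on the
ball (`GateauxHolomorphicBall.differentiableOn_of_gateaux_of_bounded`, Graves–Taylor–Hille–Zorn). [cite: Chae1985, Thm 14.9] -/
theorem differentiableOn_act_of_lineHolo {w : Pot → ℂ} {R₀ M : ℝ} (hhol : LineHolo w R₀)
    (hM : ∀ Q ∈ ball (0 : Pot) R₀, ‖w Q‖ ≤ M) : DifferentiableOn ℂ w (ball 0 R₀) :=
  differentiableOn_of_gateaux_of_bounded (fun Q₀ _ V => hhol Q₀ V) hM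

/-- [folklore] A majorant `m ≥ ‖act Q ·‖` on the step volume with the KP inequality for `2m` (weights `a + d`, `d ≥ 0`) gives the
Kotecký–Preiss condition for the activities `act Q` on every sub-family of the volume (weights `a`). -/
theorem isKPVolume_of_majorant {w : G.P → ℂ} {m : G.P → ℝ} {a d : G.P → ℝ} (hd : ∀ γ, 0 ≤ d γ) {X : C.Dom}
    (hw : ∀ γ ∈ G.vol X, ‖w γ‖ ≤ m γ)
    (hkp2 : ∀ γ ∈ G.vol X, ∑ γ' ∈ G.vol X with G.inc γ' γ, 2 * m γ' * Real.exp (a γ' + d γ') ≤ a γ) {K : Finset G.P}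
    (hK : K ⊆ G.vol X) : IsKPVolume G.inc w a K := by
  intro γ hγ
  have hγv : γ ∈ G.vol X := hK hγ
  refine le_trans ?_ (hkp2 γ hγv)
  calc ∑ γ' ∈ K with G.inc γ' γ, kpTerm w a γ'
      ≤ ∑ γ' ∈ G.vol X with G.inc γ' γ, kpTerm w a γ' := by
        refine Finset.sum_le_sum_of_subset_of_nonneg (fun γ' hγ' => ?_) fun _ _ _ => kpTerm_nonneg _ _ _
        rw [Finset.mem_filter] at hγ' ⊢
        exact ⟨hK hγ'.1, hγ'.2⟩
    _ ≤ ∑ γ' ∈ G.vol X with G.inc γ' γ, 2 * m γ' * Real.exp (a γ' + d γ') := by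
        refine Finset.sum_le_sum fun γ' hγ' => ?_
        have hγ'v : γ' ∈ G.vol X := (Finset.mem_filter.mp hγ').1
        have hm : ‖w γ'‖ ≤ m γ' := hw γ' hγ'v
        have hm0 : 0 ≤ m γ' := (norm_nonneg _).trans hm
        unfold kpTerm
        calc ‖w γ'‖ * Real.exp (a γ') ≤ m γ' * Real.exp (a γ') := mul_le_mul_of_nonneg_right hm (Real.exp_pos _).le
          _ ≤ 2 * m γ' * Real.exp (a γ' + d γ') := by
              have h1 : Real.exp (a γ') ≤ Real.exp (a γ' + d γ') := Real.exp_le_exp.mpr (le_add_of_nonneg_right (hd γ'))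
              nlinarith [Real.exp_pos (a γ'), mul_le_mul_of_nonneg_left h1 hm0]

/-- **(c-holo) FOR THE NEW TERM — the localized cluster sum is FRÉCHET-HOLOMORPHIC IN THE TABLE ON THE BALL**: every activity of
the step volume line-holomorphic on `‖Q‖ < R₀` and dominated there by `m` with the KP inequality for `2m` ⇒
`Q ↦ newTerm act k s U X Q` is complex-differentiable on `ball 0 R₀` ((♮) per activity; [KP86]: under Kotecký–Preiss all partition
functions along the rays are zero-free, so the truncated functionals are holomorphic — `differentiableOn_truncatedWeight_param_of_kp`).
[cite: Balaban1988RG2Cluster, (2.13)-(2.15) pp.14-15; KoteckyPreiss1986, p.492-493] -/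
theorem differentiableOn_newTerm {act : ℕ → ℝ → Bg → Pot → G.P → ℂ} {m : G.P → ℝ} {a d : G.P → ℝ} (hd : ∀ γ, 0 ≤ d γ)
    {k : ℕ} {s : ℝ} {U : Bg} {X : C.Dom} {R₀ : ℝ} (hhol : ∀ γ ∈ G.vol X, LineHolo (fun Q => act k s U Q γ) R₀)
    (hsup : ∀ Q ∈ ball (0 : Pot) R₀, ∀ γ ∈ G.vol X, ‖act k s U Q γ‖ ≤ m γ)
    (hkp2 : ∀ γ ∈ G.vol X, ∑ γ' ∈ G.vol X with G.inc γ' γ, 2 * m γ' * Real.exp (a γ' + d γ') ≤ a γ) :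
    DifferentiableOn ℂ (fun Q => G.newTerm act k s U X Q) (ball (0 : Pot) R₀) := by
  unfold ClusterGeom.newTerm clusterSum
  refine DifferentiableOn.fun_sum fun K hK => ?_
  refine differentiableOn_truncatedWeight_param_of_kp (v := fun Q γ => act k s U Q γ) K isOpen_ball
    (fun γ hγ => differentiableOn_act_of_lineHolo (hhol γ (G.clus_sub X K hK hγ))
      (fun Q hQ => hsup Q hQ γ (G.clus_sub X K hK hγ))) (a := a) fun Q hQ => ?_
  exact isKPVolume_of_majorant G hd (fun γ hγ => hsup Q hQ γ hγ) hkp2 (G.clus_sub X K hK)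

end Holo

/-! ## §2 The size of the new term on the inner ball, from the pencil -/

section Size

variable {Pot : Type*} [NormedAddCommGroup Pot] [NormedSpace ℂ Pot]

/-- **(c-size) FOR THE NEW TERM FROM THE PENCIL**: the pencil END's hypotheses (line-holomorphy on `R₀`, majorant `m` on the ball,
KP for `2m`, decay extraction, pin budget `B`) ⇒ `‖newTerm act k (g k) U X Q‖ ≤ B·e^{−κd(X)}` for `‖Q‖ ≤ s₀ < R₀`
(`twoPointKP_of_lineHolo_ball` ∘ `norm_newTerm_le_of_twoPointKP`; the shape of (2.41) p. 21). [cite: Balaban1988RG2Cluster, (2.40)-(2.41) p.21] -/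
theorem norm_newTerm_le_of_pencil {W : Set (ℕ → ℝ)} {act : ℕ → ℝ → Bg → Pot → G.P → ℂ} {m : ℕ → ℝ → Bg → G.P → ℝ}
    {a d : G.P → ℝ} {δ : C.Dom → ℝ} {R₀ s₀ B κ : ℝ} (ha : ∀ γ, 0 ≤ a γ) (hd : ∀ γ, 0 ≤ d γ) (hsR : s₀ < R₀)
    (hhol : ∀ g ∈ W, ∀ (k : ℕ) (U : Bg) (X : C.Dom), C.scale X = k + 1 →
      ∀ γ ∈ G.vol X, LineHolo (fun Q => act k (g k) U Q γ) R₀)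
    (hsup : ∀ g ∈ W, ∀ (k : ℕ) (U : Bg) (X : C.Dom), C.scale X = k + 1 →
      ∀ Q ∈ ball (0 : Pot) R₀, ∀ γ ∈ G.vol X, ‖act k (g k) U Q γ‖ ≤ m k (g k) U γ)
    (hkp2 : ∀ g ∈ W, ∀ (k : ℕ) (U : Bg) (X : C.Dom), C.scale X = k + 1 →
      ∀ γ ∈ G.vol X, ∑ γ' ∈ G.vol X with G.inc γ' γ, 2 * m k (g k) U γ' * Real.exp (a γ' + d γ') ≤ a γ)
    (hdec : G.DecayExtract δ d) (hpin : G.PinBudget a δ (fun _ => B) κ) {g : ℕ → ℝ} (hg : g ∈ W) {k : ℕ} {U : Bg}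
    {X : C.Dom} (hX : C.scale X = k + 1) {Q : Pot} (hQ : Q ∈ closedBall (0 : Pot) s₀) :
    ‖G.newTerm act k (g k) U X Q‖ ≤ B * Real.exp (-(κ * C.d X)) :=
  norm_newTerm_le_of_twoPointKP G
    (twoPointKP_of_lineHolo_ball G (𝒜 := fun _ => closedBall (0 : Pot) s₀) ha hd hsR (fun _ => Subset.rfl) hhol hsup hkp2)
    hdec hpin hg hX hQ

end Size

/-! ## §3 THE END OF ROUTE R4 FROM THE PENCIL LETTERS -/

section End

variable {ι : Type} [Nonempty ι] {E : Functional C Bg} {W : Set (ℕ → ℝ)} {Adm : Set (Bg → C.Dom → ℝ)}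
  {T : ℕ → (ℕ → ℝ) → (Bg → C.Dom → ℝ) → ι → ℝ} {Ψ : ℕ → ℝ → (ι → ℝ) → Bg → C.Dom → ℝ}
  {κ : ℝ} {wt : ℕ → ι → ℝ} {τ : ℕ → ℕ → ℝ} {τbar ω ωh : ℝ}

/-- **ROUTE R4's END OF RECORD FROM THE PENCIL LETTERS (one input set, two ENDs).**  Hypotheses: the END of record's structural
binders as in the pencil END `NE9TwoPointKPOfPencil.ne9_and_fadingMemory_of_lineHolo_ball_perStep` (base-free runs, admissible
class, channel additivity∕locality∕per-step size with geometric weights, factorisation, last-coupling moduli `lam k ≤ ℓ`, the reading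
`reading (wt k)`, `hΨ`) and its PENCIL DATA VERBATIM (`hhol` line-holomorphy of every activity on `‖Q‖ < R₀`, `hsup` the majorant on
that ball, `hkp2`, `hdec`, `hpin` with budget `B`), PLUS: `hΨ0` (the new term at the ZERO table has decay-weighted size `B_z`),
the admissible class closed under real scalars, a conjugation `σ` of the table space (conjugate-linear, isometric, fixing the weighted
readings of real tables — Mathlib's `star` on `lp (ι → ℂ) ∞`), and the ROOM `ω̂·s₀ + (√2·τ̄)·(2B + B_z) ≤ θ·s₀` on an inner radius
`0 < s₀ < R₀`, `0 < θ < 1`, `ω ≤ ω̂`.  Conclusion: `NE9 E W κ (prodModuli ((2∕(1−θ))·ℓ) (fun _ => 2θ∕(1+θ))) ∧ FadingMemory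
((2∕(1−θ))·ℓ ∕ (2θ∕(1+θ))) (2θ∕(1+θ)) (…)` — compare the pencil END's rate `ω + 16·B·τ̄∕(R₀ − s₀)`: here NO margin, NO Lipschitz
constant; the coupling half (R-1a) enters only through `LastCouplingLipschitz`, as there.
[cite: Balaban1988RG2Cluster, Lemma 3 (2.38) p.20 and (2.40)-(2.41) p.21; EarleHamilton1970, Theorem] -/
theorem ne9_and_fadingMemory_of_pencil_EH
    (h0 : ∀ g ∈ W, ∀ (U : Bg) (X : C.Dom), C.scale X = 0 → E g U X = 0)
    (hAdm : AdmissibleTerms E W Adm) (hres : AdmRestrict Adm) (hadd : ChannelAdditive Adm T) (hloc : ChannelLocal Adm T)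
    (hstep : ChannelSizeAtStepNN Adm T κ wt τ) (hfac : Factorises E W T Ψ) {lam : ℕ → ℝ}
    (hlast : LastCouplingLipschitz E W T Ψ κ lam)
    (hsmul : ∀ (c : ℝ), ∀ H ∈ Adm, c • H ∈ Adm) (hne : Adm.Nonempty) (hwt : ∀ m y, 0 < wt m y)
    (hτ : ∀ k j, j ≤ k → 0 ≤ τ k j ∧ τ k j ≤ τbar * ω ^ (k - j)) (hτbar : 0 < τbar) (hω : 0 ≤ ω) (hωh : 0 < ωh)
    (hωωh : ω ≤ ωh) {σ : lp (fun _ : ι => ℂ) ∞ →L[ℝ] lp (fun _ : ι => ℂ) ∞}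
    (hσ : ∀ (c : ℂ) (x : lp (fun _ : ι => ℂ) ∞), σ (c • x) = conj c • σ x) (hiso : ∀ x, ‖σ x‖ = ‖x‖)
    (hfixρ : ∀ (k : ℕ) (P : ι → ℝ), σ (reading (wt k) P) = reading (wt k) P)
    {act : ℕ → ℝ → Bg → lp (fun _ : ι => ℂ) ∞ → G.P → ℂ} {m : ℕ → ℝ → Bg → G.P → ℝ} {a d : G.P → ℝ}
    {δ : C.Dom → ℝ} {R₀ s₀ B Bz θ ℓ : ℝ} (ha : ∀ γ, 0 ≤ a γ) (hd : ∀ γ, 0 ≤ d γ) (hs₀ : 0 < s₀) (hsR : s₀ < R₀)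
    (hB : 0 ≤ B) (hBz : 0 ≤ Bz) (hθ0 : 0 < θ) (hθ1 : θ < 1) (hℓ : 0 ≤ ℓ)
    (hhol : ∀ g ∈ W, ∀ (k : ℕ) (U : Bg) (X : C.Dom), C.scale X = k + 1 →
      ∀ γ ∈ G.vol X, LineHolo (fun Q => act k (g k) U Q γ) R₀)
    (hsup : ∀ g ∈ W, ∀ (k : ℕ) (U : Bg) (X : C.Dom), C.scale X = k + 1 →
      ∀ Q ∈ ball (0 : lp (fun _ : ι => ℂ) ∞) R₀, ∀ γ ∈ G.vol X, ‖act k (g k) U Q γ‖ ≤ m k (g k) U γ)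
    (hkp2 : ∀ g ∈ W, ∀ (k : ℕ) (U : Bg) (X : C.Dom), C.scale X = k + 1 →
      ∀ γ ∈ G.vol X, ∑ γ' ∈ G.vol X with G.inc γ' γ, 2 * m k (g k) U γ' * Real.exp (a γ' + d γ') ≤ a γ)
    (hdec : G.DecayExtract δ d) (hpin : G.PinBudget a δ (fun _ => B) κ)
    (hΨ : ∀ (k : ℕ) (s : ℝ) (P P' : ι → ℝ) (U : Bg) (X : C.Dom),
      Ψ k s P U X - Ψ k s P' U X =
        (G.newTerm act k s U X (reading (wt k) P) - G.newTerm act k s U X (reading (wt k) P')).re)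
    (hΨ0 : ∀ g ∈ W, ∀ (k : ℕ) (U : Bg) (X : C.Dom), C.scale X = k + 1 →
      |Ψ k (g k) 0 U X| ≤ Real.exp (-(κ * C.d X)) * Bz)
    (hroom : ωh * s₀ + Real.sqrt 2 * τbar * (2 * B + Bz) ≤ θ * s₀) (hlam : ∀ k, lam k ≤ ℓ) :
    NE9 E W κ (prodModuli (2 / (1 - θ) * ℓ) fun _ => 2 * θ / (1 + θ)) ∧
      FadingMemory (2 / (1 - θ) * ℓ / (2 * θ / (1 + θ))) (2 * θ / (1 + θ))
        (prodModuli (2 / (1 - θ) * ℓ) fun _ => 2 * θ / (1 + θ)) := by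
  -- the complex family map: the new term plus the (real, table-free) part at the zero table
  let Φc : ℕ → ℝ → lp (fun _ : ι => ℂ) ∞ → Bg → C.Dom → ℂ := fun k s Q U X =>
    G.newTerm act k s U X Q + ((Ψ k s 0 U X - (G.newTerm act k s U X 0).re : ℝ) : ℂ)
  have hball : ball (0 : lp (fun _ : ι => ℂ) ∞) s₀ ⊆ ball 0 R₀ := ball_subset_ball hsR.le
  have hball' : ball (0 : lp (fun _ : ι => ℂ) ∞) s₀ ⊆ closedBall 0 s₀ := ball_subset_closedBall
  have h0mem : (0 : lp (fun _ : ι => ℂ) ∞) ∈ closedBall (0 : lp (fun _ : ι => ℂ) ∞) s₀ :=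
    mem_closedBall_self hs₀.le
  have hread0 : ∀ k, reading (wt k) (0 : ι → ℝ) = 0 := fun k => reading_zero_of_pos (hwt k)
  refine ne9_and_fadingMemory_of_holoFamily h0 hAdm hres hadd hloc hstep hfac hlast hsmul hne hwt hτ hτbar hω hωh hωωh
    hσ hiso hfixρ (Φc := Φc) (r := s₀) (B₁ := 2 * B + Bz) hs₀ (by positivity) hθ0 hθ1 hℓ ?_ ?_ ?_ hroom hlam
  · -- (c-holo)
    intro k g hg U X hX
    exact ((differentiableOn_newTerm G hd (hhol g hg k U X hX) (hsup g hg k U X hX) (hkp2 g hg k U X hX)).mono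
      hball).add (differentiableOn_const _)
  · -- (c-size)
    intro k g hg U X hX Q hQ
    have h1 := norm_newTerm_le_of_pencil G ha hd hsR hhol hsup hkp2 hdec hpin hg (U := U) hX (hball' hQ)
    have h2 := norm_newTerm_le_of_pencil G ha hd hsR hhol hsup hkp2 hdec hpin hg (U := U) hX h0mem
    have h3 := hΨ0 g hg k U X hX
    calc ‖Φc k (g k) Q U X‖
        ≤ ‖G.newTerm act k (g k) U X Q‖ + ‖((Ψ k (g k) 0 U X - (G.newTerm act k (g k) U X 0).re : ℝ) : ℂ)‖ :=
          norm_add_le _ _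
      _ ≤ B * Real.exp (-(κ * C.d X)) + (Real.exp (-(κ * C.d X)) * Bz + B * Real.exp (-(κ * C.d X))) := by
          refine add_le_add h1 ?_
          rw [Complex.norm_real, Real.norm_eq_abs]
          exact (abs_sub _ _).trans (add_le_add h3 ((Complex.abs_re_le_norm _).trans h2))
      _ = Real.exp (-(κ * C.d X)) * (2 * B + Bz) := by ring
  · -- (c-real)
    intro k g hg s hs U X _
    have h := hΨ k (s k) (T k s (E g)) 0 U X
    rw [hread0 k, Complex.sub_re] at h
    simp only [Φc, Complex.add_re, Complex.ofReal_re]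
    linarith

omit [Nonempty ι] in
/-- [folklore] On the table space of record `lp (ι → ℂ) ∞`, Mathlib's `star` (coordinatewise conjugation) IS an ℝ-linear continuous
map, conjugate-linear and isometric — the conjugation the END above asks for (leaf-02 g31's `SymmetryPrincipleBanachStar` §3.0
keeps this plumbing private; re-derived here in five lines). -/
theorem exists_star_clm_lp :
    ∃ σ : lp (fun _ : ι => ℂ) ∞ →L[ℝ] lp (fun _ : ι => ℂ) ∞, (∀ x, σ x = star x) ∧
      (∀ (c : ℂ) (x : lp (fun _ : ι => ℂ) ∞), σ (c • x) = conj c • σ x) ∧ ∀ x, ‖σ x‖ = ‖x‖ := by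
  refine ⟨{ toFun := star, map_add' := star_add,
            map_smul' := fun r x => ?_, cont := continuous_star }, fun _ => rfl, fun c x => ?_, fun x => norm_star x⟩
  · rw [RingHom.id_apply, star_smul, star_trivial]
  · show star (c • x) = conj c • star x
    rw [star_smul, Complex.star_def]

/-- **ROUTE R4's END OF RECORD FROM THE PENCIL LETTERS — `star` INSTANTIATED (no conjugation hypothesis left).**  Displayed inputs =
the pencil END's (`NE9TwoPointKPOfPencil.ne9_and_fadingMemory_of_lineHolo_ball_perStep`: structural binders, `hhol`, `hsup`, `hkp2`,
`hdec`, `hpin`, `hΨ` with `ρ := reading (wt k)`) + base-free runs `h0` + `Adm` closed under real scalars + `hΨ0` (size of the new term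
at the zero table) + the ROOM `ω̂·s₀ + (√2·τ̄)·(2B + B_z) ≤ θ·s₀` (`0 < s₀ < R₀`).  Conclusion: `NE9 ∧ FadingMemory` with
`prodModuli ((2∕(1−θ))·ℓ) (fun _ => 2θ∕(1+θ))`.  «NE9 ⇐ the named binders»; the Earle–Hamilton END beside the renewal END, SAME
Bałaban-side inputs. [cite: Balaban1988RG2Cluster, Lemma 3 (2.38) p.20 and (2.40)-(2.41) p.21; EarleHamilton1970, Theorem] -/
theorem ne9_and_fadingMemory_of_pencil_EH_star
    (h0 : ∀ g ∈ W, ∀ (U : Bg) (X : C.Dom), C.scale X = 0 → E g U X = 0)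
    (hAdm : AdmissibleTerms E W Adm) (hres : AdmRestrict Adm) (hadd : ChannelAdditive Adm T) (hloc : ChannelLocal Adm T)
    (hstep : ChannelSizeAtStepNN Adm T κ wt τ) (hfac : Factorises E W T Ψ) {lam : ℕ → ℝ}
    (hlast : LastCouplingLipschitz E W T Ψ κ lam)
    (hsmul : ∀ (c : ℝ), ∀ H ∈ Adm, c • H ∈ Adm) (hne : Adm.Nonempty) (hwt : ∀ m y, 0 < wt m y)
    (hτ : ∀ k j, j ≤ k → 0 ≤ τ k j ∧ τ k j ≤ τbar * ω ^ (k - j)) (hτbar : 0 < τbar) (hω : 0 ≤ ω) (hωh : 0 < ωh)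
    (hωωh : ω ≤ ωh)
    {act : ℕ → ℝ → Bg → lp (fun _ : ι => ℂ) ∞ → G.P → ℂ} {m : ℕ → ℝ → Bg → G.P → ℝ} {a d : G.P → ℝ}
    {δ : C.Dom → ℝ} {R₀ s₀ B Bz θ ℓ : ℝ} (ha : ∀ γ, 0 ≤ a γ) (hd : ∀ γ, 0 ≤ d γ) (hs₀ : 0 < s₀) (hsR : s₀ < R₀)
    (hB : 0 ≤ B) (hBz : 0 ≤ Bz) (hθ0 : 0 < θ) (hθ1 : θ < 1) (hℓ : 0 ≤ ℓ)
    (hhol : ∀ g ∈ W, ∀ (k : ℕ) (U : Bg) (X : C.Dom), C.scale X = k + 1 →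
      ∀ γ ∈ G.vol X, LineHolo (fun Q => act k (g k) U Q γ) R₀)
    (hsup : ∀ g ∈ W, ∀ (k : ℕ) (U : Bg) (X : C.Dom), C.scale X = k + 1 →
      ∀ Q ∈ ball (0 : lp (fun _ : ι => ℂ) ∞) R₀, ∀ γ ∈ G.vol X, ‖act k (g k) U Q γ‖ ≤ m k (g k) U γ)
    (hkp2 : ∀ g ∈ W, ∀ (k : ℕ) (U : Bg) (X : C.Dom), C.scale X = k + 1 →
      ∀ γ ∈ G.vol X, ∑ γ' ∈ G.vol X with G.inc γ' γ, 2 * m k (g k) U γ' * Real.exp (a γ' + d γ') ≤ a γ)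
    (hdec : G.DecayExtract δ d) (hpin : G.PinBudget a δ (fun _ => B) κ)
    (hΨ : ∀ (k : ℕ) (s : ℝ) (P P' : ι → ℝ) (U : Bg) (X : C.Dom),
      Ψ k s P U X - Ψ k s P' U X =
        (G.newTerm act k s U X (reading (wt k) P) - G.newTerm act k s U X (reading (wt k) P')).re)
    (hΨ0 : ∀ g ∈ W, ∀ (k : ℕ) (U : Bg) (X : C.Dom), C.scale X = k + 1 →
      |Ψ k (g k) 0 U X| ≤ Real.exp (-(κ * C.d X)) * Bz)
    (hroom : ωh * s₀ + Real.sqrt 2 * τbar * (2 * B + Bz) ≤ θ * s₀) (hlam : ∀ k, lam k ≤ ℓ) :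
    NE9 E W κ (prodModuli (2 / (1 - θ) * ℓ) fun _ => 2 * θ / (1 + θ)) ∧
      FadingMemory (2 / (1 - θ) * ℓ / (2 * θ / (1 + θ))) (2 * θ / (1 + θ))
        (prodModuli (2 / (1 - θ) * ℓ) fun _ => 2 * θ / (1 + θ)) := by
  obtain ⟨σ, hσa, hσ, hiso⟩ := exists_star_clm_lp (ι := ι)
  exact ne9_and_fadingMemory_of_pencil_EH G h0 hAdm hres hadd hloc hstep hfac hlast hsmul hne hwt hτ hτbar hω hωh hωωh hσ hiso
    (fun k P => by rw [hσa]; exact (isSelfAdjoint_reading (wt k) P).star_eq) ha hd hs₀ hsR hB hBz hθ0 hθ1 hℓ hhol hsup hkp2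
    hdec hpin hΨ hΨ0 hroom hlam

end End

end Summit.QuantumFields.BalabanUV.T4Continuum.NE9HoloFamilyOfPencil

end
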